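import Summits.QuantumFields.BalabanUV.Beta.EriceRemainderEnclosureHistoryAutonomyComparisonAgeCompositionIdentification
import Summits.QuantumFields.BalabanUV.Beta.EriceRemainderEnclosureHistoryAutonomyComparisonAgeCompositionHarnack

/-!
# EriceRemainderEnclosureHistoryAutonomyComparisonAgeCompositionIdentificationEnd — (E75b) THE IDENTIFICATION FILE OF ROUTE (N), part 2: the persistence
# defect of the flow's first-order read weights is below the universal defect, **`θ̂_k(m;y) ≤ θ̄(k∕y) = 1 − (r∕(r+1))^{3∕2}e^{−1∕(2r)}`** (`r = k∕y`) — level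
# concavity from the age's own scale (coefficient decay `≥ (k∕(k+y))^{3∕2}`) and the row-mass bound `F_{m+j} ≤ 1∕(2j)` below every pin (extra damping
# `≥ e^{−y∕(2k)}`) —, and the END of the identification: KEY at the pin `m` for the flow's first-order objects follows from ONE inequality in budget loads,
# universal defects and drop ratios, **`x_y(m)·(v_m + Σ_k θ̄(k∕y)·d_k(m)) ≤ (1 − Ω^u_m)·v_m`**, by (E71c) `key_of_harnack_load` with (E75a)'s structure
# and data orderings — the window-mass chain's step `x_y(1+V) ≤ 1 − Ω^u` once the carried ratios bound `d_k(m)∕v_m` ((E71d), (E72a))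

Cell `pub-balaban`, β-function sub-cell, BINDER row D4 «RemainderConst leaves for Bałaban's split» (`HOME/BINDER-OWNERS.md`; owner lineage `b2b-balaban-beta-an4`;
this file by co-owner #2 lineage `b2b-balaban-beta-d4-p2`, generation 66), β-FLOW TEAM duty (1), FREEZE (0) honoured (def-free; imports (E75a)
`…AgeCompositionIdentification` and (E71c) `…AgeCompositionHarnack`; uses `memFlow_tail`, `strictAnti_of_memFlow` (E48a), `mul_sqrt_le_read`,
`mul_read_le_invSq_of_dom` (E58b), `key_of_harnack_load` (E71c), (E75a)'s §1–§2 BY NAME; nothing restated).  Successor item (1) of README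
`HOME/b2b-balaban-beta-d4-p2/g65/e74/README.md` §6.

HONEST FRAMING (page 1, verbatim and binding).  *"Discharging BetaPertH makes Bałaban's UV stability UNCONDITIONAL — a real constructive-QFT result; it is
NOT the continuum limit and NOT the Clay problem."*  THIS FILE DISCHARGES NOTHING OF THE KIND.  Elementary real analysis about ABSTRACT functionals on a box
]0,γ]^ℕ with displayed floors, profiles and signs, and about the FIRST-ORDER renewal objects of route (N) built from them — hypotheses of a census, not
facts; the form, signs, ages and moments of Bałaban's (1.22) limit functional are NOT PRINTED ([I] p. 298; GAPS G-t4-U2-1∕-2) and NOT asserted.  Row D4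
class UNCHANGED (critical-path width 0; instance 0∕1; D4 DISCHARGE NO DATE).  HONEST DEPENDENCY: continuum YM on T⁴ ⇐ BetaPertH ∧ nine spine estimates (0/9
proved); BetaPertH ⇐ (D1) ∧ (D4) ∧ CAP+tail; G-an2-4 gates asym, D1 and NE2/3/4.

THE OBJECTS: as in (E75a) (module docstring there): `E k m i = [y<k<K]·[i<k]·(L_k h_{m+k}³∕2)·Π_{t=m+1+i}^{m+k} g_t`, `Ky m l = [l<y]·(L_y h_{m+y}³∕2)·Π_{t=m+1+l}^{m+y} g_t`,
`θ̂_k(m;l) = 1 − (h_{m+k+l}∕h_{m+k})³·Π_{t=m+k+1}^{m+k+l} g_t`, dampings `1∕(1+F_t) ≤ g_t ≤ 1` with `F_t = Σ_{k<K} L_k h_{t+k}³∕2` (the first-order pin damping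
`g_t = 1∕(1+f_t)`, `0 ≤ f_t ≤ F_t`, is one of them), loads `x_k(m) = k·L_k·h_{m+k}³∕2`; `θ̄` in (E72c)'s letters `1 − r∕(r+1)·√(r∕(r+1))·e^{−1∕(2r)}`.

WHAT IS PROVED ([folklore]; 0 `def`, 0 sorry).  §1 THE DEFECT BOUND: `rowMass_le` (`F_{m+j} ≤ 1∕(2j)`, `j ≥ 1`, below every pin), `damping_ge_exp` (`g_{m+j} ≥
e^{−1∕(2j)}`), **`prod_damping_ge_exp`** (`Π_{t=m+k+1}^{m+k+l} g_t ≥ e^{−l∕(2k)}`), **`cube_ratio_ge`** (`(h_{m+k+l}∕h_{m+k})³ ≥ (k∕(k+l))·√(k∕(k+l))`),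
`thetabar_letters`, **`defect_le_thetabar`** (`θ̂_k(m;y) ≤ θ̄(k∕y)`, `k, y ≥ 1`, every pin).  §2 END: **`key_at_pin_of_window_mass_ineq`**.  NOT CLAIMED: the
static closure (budget form or flow form); MONO; (E58′); anything nonlinear; anything printed.
-/
noncomputable section
open Finset

namespace Summit.QuantumFields.BalabanUV.Beta.EriceRemainderEnclosureHistoryAutonomyComparisonAgeCompositionIdentificationEnd

open Literature.MathematicalPhysics.QuantumFieldTheory.Balaban1983to89
open Literature.MathematicalPhysics.QuantumFieldTheory.Balaban1983to89.T4BetaStationary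
open Literature.MathematicalPhysics.QuantumFieldTheory.Balaban1983to89.T4BetaFlowWellPosed
open Summit.QuantumFields.BalabanUV.Beta.EriceRemainderEnclosureHistoryAutonomyOrder (memFlow_tail strictAnti_of_memFlow)
open Summit.QuantumFields.BalabanUV.Beta.EriceRemainderEnclosureHistoryAutonomyComparisonAffineProfile (mul_sqrt_le_read mul_read_le_invSq_of_dom)
open Summit.QuantumFields.BalabanUV.Beta.EriceRemainderEnclosureHistoryAutonomyComparisonAgeCompositionHarnack (key_of_harnack_load)
open Summit.QuantumFields.BalabanUV.Beta.EriceRemainderEnclosureHistoryAutonomyComparisonAgeCompositionIdentification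

variable {B : (ℕ → ℝ) → ℝ} {γ b gIR : ℝ} {L : ℕ → ℝ} {K y : ℕ} {h g : ℕ → ℝ} {E θ : ℕ → ℕ → ℕ → ℝ} {Ky : ℕ → ℕ → ℝ}

/-! ## §1 The defect bound `θ̂_k(m;y) ≤ θ̄(k∕y)` along the flow -/

/-- **THE UNDAMPED ROW MASS AT DEPTH `j ≥ 1` BELOW ANY PIN**: `F_{m+j} = Σ_{k<K} L_k h_{m+j+k}³∕2 ≤ 1∕(2j)` — from `j·Σ_k L_k h_{m+j+k} ≤ 1∕h_{m+j}²` for the tail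
flow from the pin `h_m` ((E58b) `mul_read_le_invSq_of_dom`) and `h_{m+j+k} ≤ h_{m+j}`. [folklore] -/
theorem rowMass_le (hmono : ∀ u v : ℕ → ℝ, SeqBox γ u → SeqBox γ v → (∀ j, u j ≤ v j) → B u ≤ B v) (hL : ∀ k, 0 ≤ L k)
    (hb : 0 < b) (hlo : ∀ u, SeqBox γ u → b ≤ B u) (hdom : ∀ u, SeqBox γ u → ∑ k ∈ range K, L k * u k ≤ B u)
    (hh : SeqBox γ h) (hf : MemFlow B gIR h) (m : ℕ) {j : ℕ} (hj : 1 ≤ j) :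
    ∑ k ∈ range K, L k * h (m + j + k) ^ 3 / 2 ≤ 1 / (2 * (j : ℝ)) := by
  have hjr : (0 : ℝ) < j := by exact_mod_cast hj
  have hhm := seqBox_shift hh m
  have hfm := memFlow_tail hf m
  have hread := mul_read_le_invSq_of_dom hmono hL hb hlo hdom (hh m).1 hhm hfm j
  have hanti := (strictAnti_of_memFlow hb hlo hh hf).antitone
  have hpos := (hh (m + j)).1
  -- Σ L h³ ≤ h_{m+j}² Σ L h
  have h1 : ∑ k ∈ range K, L k * h (m + j + k) ^ 3 ≤ h (m + j) ^ 2 * ∑ k ∈ range K, L k * h (m + (j + k)) := by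
    rw [mul_sum]
    refine sum_le_sum fun k _ => ?_
    have hle : h (m + j + k) ≤ h (m + j) := hanti (by omega)
    have h0 : 0 ≤ h (m + j + k) := (hh _).1.le
    have hsq : h (m + j + k) ^ 2 ≤ h (m + j) ^ 2 := pow_le_pow_left₀ h0 hle 2
    rw [show m + (j + k) = m + j + k by omega]
    calc L k * h (m + j + k) ^ 3 = h (m + j + k) ^ 2 * (L k * h (m + j + k)) := by ring
      _ ≤ h (m + j) ^ 2 * (L k * h (m + j + k)) := mul_le_mul_of_nonneg_right hsq (mul_nonneg (hL k) h0)
  have h2 : (j : ℝ) * ∑ k ∈ range K, L k * h (m + (j + k)) ≤ 1 / h (m + j) ^ 2 := hread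
  have h3 : ∑ k ∈ range K, L k * h (m + (j + k)) ≤ 1 / ((j : ℝ) * h (m + j) ^ 2) := by
    rw [le_div_iff₀ (by positivity)]
    calc (∑ k ∈ range K, L k * h (m + (j + k))) * ((j : ℝ) * h (m + j) ^ 2)
        = ((j : ℝ) * ∑ k ∈ range K, L k * h (m + (j + k))) * h (m + j) ^ 2 := by ring
      _ ≤ 1 / h (m + j) ^ 2 * h (m + j) ^ 2 := mul_le_mul_of_nonneg_right h2 (by positivity)
      _ = 1 := by field_simp
  have h4 : ∑ k ∈ range K, L k * h (m + j + k) ^ 3 ≤ 1 / (j : ℝ) := by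
    calc ∑ k ∈ range K, L k * h (m + j + k) ^ 3 ≤ h (m + j) ^ 2 * (1 / ((j : ℝ) * h (m + j) ^ 2)) :=
          h1.trans (mul_le_mul_of_nonneg_left h3 (by positivity))
      _ = 1 / (j : ℝ) := by field_simp
  calc ∑ k ∈ range K, L k * h (m + j + k) ^ 3 / 2 = (∑ k ∈ range K, L k * h (m + j + k) ^ 3) / 2 := by rw [← sum_div]
    _ ≤ (1 / (j : ℝ)) / 2 := by gcongr
    _ = 1 / (2 * (j : ℝ)) := by field_simp

/-- **ONE DAMPING IS AT LEAST `e^{−1∕(2j)}` AT DEPTH `j ≥ 1` BELOW THE PIN**: `g_{m+j} ≥ 1∕(1+F_{m+j}) ≥ 1∕(1+1∕(2j)) ≥ e^{−1∕(2j)}` (`1 + a ≤ e^a`). [folklore] -/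
theorem damping_ge_exp (hmono : ∀ u v : ℕ → ℝ, SeqBox γ u → SeqBox γ v → (∀ j, u j ≤ v j) → B u ≤ B v) (hL : ∀ k, 0 ≤ L k)
    (hb : 0 < b) (hlo : ∀ u, SeqBox γ u → b ≤ B u) (hdom : ∀ u, SeqBox γ u → ∑ k ∈ range K, L k * u k ≤ B u)
    (hh : SeqBox γ h) (hf : MemFlow B gIR h) (hgF : ∀ t, 1 / (1 + ∑ k ∈ range K, L k * h (t + k) ^ 3 / 2) ≤ g t)
    (m : ℕ) {j : ℕ} (hj : 1 ≤ j) : Real.exp (-(1 / (2 * (j : ℝ)))) ≤ g (m + j) := by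
  have hjr : (0 : ℝ) < j := by exact_mod_cast hj
  have hF := rowMass_le hmono hL hb hlo hdom hh hf m hj
  have hF0 : 0 ≤ ∑ k ∈ range K, L k * h (m + j + k) ^ 3 / 2 :=
    sum_nonneg fun k _ => div_nonneg (mul_nonneg (hL k) (pow_nonneg (hh _).1.le 3)) (by norm_num)
  -- e^{-a} ≤ 1/(1+a) ≤ 1/(1+F) ≤ g
  have ha : 0 < 1 / (2 * (j : ℝ)) := by positivity
  have h1 : Real.exp (-(1 / (2 * (j : ℝ)))) ≤ 1 / (1 + 1 / (2 * (j : ℝ))) := by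
    rw [Real.exp_neg, le_div_iff₀ (by positivity)]
    have := Real.add_one_le_exp (1 / (2 * (j : ℝ)))
    have hexp : 0 < Real.exp (1 / (2 * (j : ℝ))) := Real.exp_pos _
    calc (Real.exp (1 / (2 * (j : ℝ))))⁻¹ * (1 + 1 / (2 * (j : ℝ))) ≤ (Real.exp (1 / (2 * (j : ℝ))))⁻¹ * Real.exp (1 / (2 * (j : ℝ))) :=
          mul_le_mul_of_nonneg_left (by linarith) (inv_nonneg.mpr hexp.le)
      _ = 1 := inv_mul_cancel₀ hexp.ne'
  have h2 : 1 / (1 + 1 / (2 * (j : ℝ))) ≤ 1 / (1 + ∑ k ∈ range K, L k * h (m + j + k) ^ 3 / 2) :=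
    one_div_le_one_div_of_le (by positivity) (by linarith)
  exact h1.trans (h2.trans (hgF (m + j)))

/-- **THE EXTRA DAMPING OVER A SHIFT IS AT LEAST `e^{−l∕(2k)}`**: for an age `k ≥ 1` at the pin `m` and a shift `l`, `Π_{t=m+k+1}^{m+k+l} g_t ≥ e^{−l∕(2(k+1))}
≥ e^{−l∕(2k)}` — each of the `l` dampings sits at depth `≥ k+1` below the pin. [folklore] -/
theorem prod_damping_ge_exp (hmono : ∀ u v : ℕ → ℝ, SeqBox γ u → SeqBox γ v → (∀ j, u j ≤ v j) → B u ≤ B v) (hL : ∀ k, 0 ≤ L k)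
    (hb : 0 < b) (hlo : ∀ u, SeqBox γ u → b ≤ B u) (hdom : ∀ u, SeqBox γ u → ∑ k ∈ range K, L k * u k ≤ B u)
    (hh : SeqBox γ h) (hf : MemFlow B gIR h) (hgF : ∀ t, 1 / (1 + ∑ k ∈ range K, L k * h (t + k) ^ 3 / 2) ≤ g t)
    (m : ℕ) {k : ℕ} (hk : 1 ≤ k) (l : ℕ) :
    Real.exp (-((l : ℝ) / (2 * k))) ≤ ∏ t ∈ Ico (m + k + 1) (m + k + l + 1), g t := by
  have hkr : (0 : ℝ) < k := by exact_mod_cast hk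
  -- each factor ≥ e^{-1/(2(k+1))} ≥ e^{-1/(2k)}
  have hfac : ∀ t ∈ Ico (m + k + 1) (m + k + l + 1), Real.exp (-(1 / (2 * (k : ℝ)))) ≤ g t := by
    intro t ht
    rw [mem_Ico] at ht
    obtain ⟨j, hj, rfl⟩ : ∃ j, k + 1 ≤ j ∧ t = m + j := ⟨t - m, by omega, by omega⟩
    have hjr : (k : ℝ) + 1 ≤ j := by exact_mod_cast hj
    have h1 := damping_ge_exp hmono hL hb hlo hdom hh hf hgF m (show 1 ≤ j by omega)
    refine le_trans (Real.exp_le_exp.mpr ?_) h1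
    have : 1 / (2 * (j : ℝ)) ≤ 1 / (2 * (k : ℝ)) := one_div_le_one_div_of_le (by positivity) (by linarith)
    linarith
  have hcard : (Ico (m + k + 1) (m + k + l + 1)).card = l := by rw [Nat.card_Ico]; omega
  calc Real.exp (-((l : ℝ) / (2 * k))) = Real.exp (-(1 / (2 * (k : ℝ)))) ^ l := by
        rw [← Real.exp_nat_mul]; congr 1; field_simp
    _ = ∏ _t ∈ Ico (m + k + 1) (m + k + l + 1), Real.exp (-(1 / (2 * (k : ℝ)))) := by rw [prod_const, hcard]
    _ ≤ ∏ t ∈ Ico (m + k + 1) (m + k + l + 1), g t := prod_le_prod (fun t _ => (Real.exp_pos _).le) hfac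

/-- **THE COEFFICIENT DECAY IS AT MOST `(k∕(k+l))^{3∕2}`**: `(h_{m+k+l}∕h_{m+k})³ ≥ (k∕(k+l))·√(k∕(k+l))` — level concavity from the age's own scale for the tail
flow from the pin `h_m` ((E58b) `mul_sqrt_le_read`). [folklore] -/
theorem cube_ratio_ge (hmono : ∀ u v : ℕ → ℝ, SeqBox γ u → SeqBox γ v → (∀ j, u j ≤ v j) → B u ≤ B v)
    (hb : 0 < b) (hlo : ∀ u, SeqBox γ u → b ≤ B u) (hh : SeqBox γ h) (hf : MemFlow B gIR h) (m k l : ℕ) :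
    (k : ℝ) / ((k : ℝ) + l) * Real.sqrt ((k : ℝ) / ((k : ℝ) + l)) ≤ (h (m + k + l) / h (m + k)) ^ 3 := by
  have hread := mul_sqrt_le_read hmono hb hlo (hh m).1 (seqBox_shift hh m) (memFlow_tail hf m) k l
  have hpos : 0 < h (m + k) := (hh _).1
  have hs0 : 0 ≤ Real.sqrt ((k : ℝ) / ((k : ℝ) + l)) := Real.sqrt_nonneg _
  have hq0 : 0 ≤ (k : ℝ) / ((k : ℝ) + l) := div_nonneg (Nat.cast_nonneg k) (by positivity)
  -- √(k/(k+l)) ≤ h(m+k+l)/h(m+k)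
  have hr : Real.sqrt ((k : ℝ) / ((k : ℝ) + l)) ≤ h (m + k + l) / h (m + k) := by
    rw [le_div_iff₀ hpos, show m + k + l = m + (k + l) by omega]
    exact hread
  have h3 := pow_le_pow_left₀ hs0 hr 3
  calc (k : ℝ) / ((k : ℝ) + l) * Real.sqrt ((k : ℝ) / ((k : ℝ) + l))
      = Real.sqrt ((k : ℝ) / ((k : ℝ) + l)) ^ 3 := by
        rw [pow_succ, Real.sq_sqrt hq0]
    _ ≤ (h (m + k + l) / h (m + k)) ^ 3 := h3

/-- (E72c)'s letters: for `y ≥ 1`, `(k∕y)∕((k∕y)+1) = k∕(k+y)` and `1∕(2·(k∕y)) = y∕(2k)`. [folklore] -/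
theorem thetabar_letters {k y : ℕ} (hk : 1 ≤ k) (hy : 1 ≤ y) :
    ((k : ℝ) / y) / ((k : ℝ) / y + 1) = (k : ℝ) / ((k : ℝ) + y) ∧ 1 / (2 * ((k : ℝ) / y)) = (y : ℝ) / (2 * k) := by
  have hkr : (0 : ℝ) < k := by exact_mod_cast hk
  have hyr : (0 : ℝ) < y := by exact_mod_cast hy
  constructor
  · field_simp
  · field_simp

/-- **THE DEFECT BOUND `θ̂_k(m;y) ≤ θ̄(k∕y)`** — the third datum ordering of the majorant chain, in (E72c)'s letters
`θ̄(r) = 1 − r∕(r+1)·√(r∕(r+1))·e^{−1∕(2r)}`, `r = k∕y` (`k, y ≥ 1`): along every box solution of an isotone memory with floor dominated by `L`, at EVERY pin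
`m`, for ANY dampings with `1∕(1+F_t) ≤ g_t ≤ 1`.  (Coefficient decay by `cube_ratio_ge`, extra damping by `prod_damping_ge_exp`.) [folklore] -/
theorem defect_le_thetabar (hmono : ∀ u v : ℕ → ℝ, SeqBox γ u → SeqBox γ v → (∀ j, u j ≤ v j) → B u ≤ B v) (hL : ∀ k, 0 ≤ L k)
    (hb : 0 < b) (hlo : ∀ u, SeqBox γ u → b ≤ B u) (hdom : ∀ u, SeqBox γ u → ∑ k ∈ range K, L k * u k ≤ B u)
    (hh : SeqBox γ h) (hf : MemFlow B gIR h) (hgF : ∀ t, 1 / (1 + ∑ k ∈ range K, L k * h (t + k) ^ 3 / 2) ≤ g t)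
    (hθ : ∀ k m l, θ k m l = 1 - (h (m + k + l) / h (m + k)) ^ 3 * ∏ t ∈ Ico (m + k + 1) (m + k + l + 1), g t)
    (m : ℕ) {k : ℕ} (hk : 1 ≤ k) (hy : 1 ≤ y) :
    θ k m y ≤ 1 - ((k : ℝ) / y) / ((k : ℝ) / y + 1) * Real.sqrt (((k : ℝ) / y) / ((k : ℝ) / y + 1)) * Real.exp (-(1 / (2 * ((k : ℝ) / y)))) := by
  obtain ⟨e1, e2⟩ := thetabar_letters hk hy
  rw [e1, e2, hθ]
  have hc := cube_ratio_ge hmono hb hlo hh hf m k y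
  have hp := prod_damping_ge_exp hmono hL hb hlo hdom hh hf hgF m hk y
  have hc0 : 0 ≤ (k : ℝ) / ((k : ℝ) + y) * Real.sqrt ((k : ℝ) / ((k : ℝ) + y)) :=
    mul_nonneg (div_nonneg (Nat.cast_nonneg k) (by positivity)) (Real.sqrt_nonneg _)
  have hprod := mul_le_mul hc hp (Real.exp_pos _).le ((hc0).trans hc)
  linarith

/-! ## §2 END: KEY at the pin from the window-mass Harnack-load inequality -/

/-- **KEY AT THE PIN `m` FOR THE FLOW'S FIRST-ORDER OBJECTS, FROM ONE INEQUALITY IN BUDGET LOADS, UNIVERSAL DEFECTS AND DROP RATIOS.**  `B` isotone with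
floor `b > 0` dominated by `L ≥ 0` on the ages `< K`; `h` a box solution from the pin `gIR`; dampings `1∕(1+F_t) ≤ g_t ≤ 1`; the old read weights `E`
(ages `y < k < K`), the young kernel `Ky` (age `y`, `1 ≤ y`) and the defects `θ` as displayed; the old surplus `v ≥ 0` of the stage, `v_n = w_n − Σ_{k<K}
Σ_{i<K} E k n i·v_{n+1+i}` with `w` non-increasing.  If the undamped window mass `Ω^u_m = Σ_{y<k<K} x_k(m)·y∕k < 1` and
**`x_y(m)·(v_m + Σ_{k<K} θ̄(k∕y)·d_k(m)) ≤ (1 − Ω^u_m)·v_m`** (`d_k(m) = Σ_i E k m i·v_{m+1+i}` the drop of age `k` at the pin, `x_y(m) = y·L_y·h_{m+y}³∕2`),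
then KEY holds at `m`: `Σ_l Ky m l·v_{m+1+l} ≤ v_m`.  Proof: (E71c) `key_of_harnack_load` with §1 (structure), §2 (`x̃ ≤ x`, `Ω_m ≤ Ω^u`) and §3 (`θ̂ ≤ θ̄`).
With the static chain's carried ratios `d_k(m) ≤ b_{m,k}·v_m` ((E71d), (E72a) `chain_le_of_data_le`) the displayed inequality is the window-mass chain's step
`x_y(1 + V) ≤ 1 − Ω^u` — so a certified closure of that chain over (E65a)'s polytope (§4) IS KEY at every pin, modulo MONO∕MONO′. [folklore] -/
theorem key_at_pin_of_window_mass_ineq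
    (hmono : ∀ u v : ℕ → ℝ, SeqBox γ u → SeqBox γ v → (∀ j, u j ≤ v j) → B u ≤ B v) (hL : ∀ k, 0 ≤ L k)
    (hb : 0 < b) (hlo : ∀ u, SeqBox γ u → b ≤ B u) (hdom : ∀ u, SeqBox γ u → ∑ k ∈ range K, L k * u k ≤ B u)
    (hh : SeqBox γ h) (hf : MemFlow B gIR h)
    (hg : ∀ t, 0 < g t ∧ g t ≤ 1) (hgF : ∀ t, 1 / (1 + ∑ k ∈ range K, L k * h (t + k) ^ 3 / 2) ≤ g t)
    (hE : ∀ k m i, E k m i = if y < k ∧ k < K ∧ i < k then L k * h (m + k) ^ 3 / 2 * ∏ t ∈ Ico (m + 1 + i) (m + k + 1), g t else 0)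
    (hKy : ∀ m l, Ky m l = if l < y then L y * h (m + y) ^ 3 / 2 * ∏ t ∈ Ico (m + 1 + l) (m + y + 1), g t else 0)
    (hθ : ∀ k m l, θ k m l = 1 - (h (m + k + l) / h (m + k)) ^ 3 * ∏ t ∈ Ico (m + k + 1) (m + k + l + 1), g t)
    {v w : ℕ → ℝ} (hv0 : ∀ n, 0 ≤ v n) (hw : ∀ n, w (n + 1) ≤ w n)
    (heq : ∀ n, v n = w n - ∑ k ∈ range K, ∑ i ∈ range K, E k n i * v (n + 1 + i))
    {m : ℕ} (hy : 1 ≤ y)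
    (hΩu : ∑ k ∈ (range K).filter (y < ·), L k * k * h (m + k) ^ 3 / 2 * ((y : ℝ) / k) < 1)
    (hstar : L y * y * h (m + y) ^ 3 / 2 *
        (v m + ∑ k ∈ range K, (1 - ((k : ℝ) / y) / ((k : ℝ) / y + 1) * Real.sqrt (((k : ℝ) / y) / ((k : ℝ) / y + 1)) *
            Real.exp (-(1 / (2 * ((k : ℝ) / y))))) * ∑ i ∈ range K, E k m i * v (m + 1 + i)) ≤
      (1 - ∑ k ∈ (range K).filter (y < ·), L k * k * h (m + k) ^ 3 / 2 * ((y : ℝ) / k)) * v m) :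
    ∑ l ∈ range K, Ky m l * v (m + 1 + l) ≤ v m := by
  have hh0 : ∀ n, 0 < h n := fun n => (hh n).1
  have hanti := (strictAnti_of_memFlow hb hlo hh hf).antitone
  have hE0 := weight_nonneg hL hh0 hg hE
  have hΩle := window_mass_le_undamped hL hh0 hg hE m (K := K) (y := y)
  -- the true Harnack load is below the θ̄-weighted one
  have hd0 : ∀ k, 0 ≤ ∑ i ∈ range K, E k m i * v (m + 1 + i) := fun k => sum_nonneg fun i _ => mul_nonneg (hE0 k m i) (hv0 _)
  have hS : ∑ k ∈ range K, θ k m y * ∑ i ∈ range K, E k m i * v (m + 1 + i) ≤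
      ∑ k ∈ range K, (1 - ((k : ℝ) / y) / ((k : ℝ) / y + 1) * Real.sqrt (((k : ℝ) / y) / ((k : ℝ) / y + 1)) *
        Real.exp (-(1 / (2 * ((k : ℝ) / y))))) * ∑ i ∈ range K, E k m i * v (m + 1 + i) := by
    refine sum_le_sum fun k _ => ?_
    rcases Nat.eq_zero_or_pos k with rfl | hk
    · have hz : ∑ i ∈ range K, E 0 m i * v (m + 1 + i) = 0 := sum_eq_zero fun i _ => by
        rw [hE, if_neg (by omega), zero_mul]
      rw [hz, mul_zero, mul_zero]
    · exact mul_le_mul_of_nonneg_right (defect_le_thetabar hmono hL hb hlo hdom hh hf hgF hθ m hk hy) (hd0 k)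
  have hx := young_load_le hL hh0 hg hKy m (K := K)
  have hx0 : 0 ≤ ∑ l ∈ range K, Ky m l := sum_nonneg fun l _ => young_weight_nonneg hL hh0 hg hKy m l
  have hS0 : 0 ≤ ∑ k ∈ range K, θ k m y * ∑ i ∈ range K, E k m i * v (m + 1 + i) :=
    sum_nonneg fun k _ => mul_nonneg (defect_nonneg hh0 hanti hg hθ k m y) (hd0 k)
  refine key_of_harnack_load (N := K) (A := K) hE0 (weight_eq_zero_of_horizon hE) (defect_nonneg hh0 hanti hg hθ) hv0 hw heq
    (fun k _ l _ _ i => persistence hL hh0 hg hE hθ k m l i) (fun k l _ hly => defect_mono hh0 hanti hg hθ k m hly)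
    (young_weight_nonneg hL hh0 hg hKy m) (young_weight_eq_zero hKy m) hy (lt_of_le_of_lt hΩle hΩu) ?_
  -- x̃ (v + S) ≤ x (v + S̄) ≤ (1 − Ω^u) v ≤ (1 − Ω) v
  calc (∑ l ∈ range K, Ky m l) * (v m + ∑ k ∈ range K, θ k m y * ∑ i ∈ range K, E k m i * v (m + 1 + i))
      ≤ L y * y * h (m + y) ^ 3 / 2 *
        (v m + ∑ k ∈ range K, (1 - ((k : ℝ) / y) / ((k : ℝ) / y + 1) * Real.sqrt (((k : ℝ) / y) / ((k : ℝ) / y + 1)) *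
            Real.exp (-(1 / (2 * ((k : ℝ) / y))))) * ∑ i ∈ range K, E k m i * v (m + 1 + i)) :=
        mul_le_mul hx (by linarith) (by linarith [hv0 m]) (by linarith)
    _ ≤ (1 - ∑ k ∈ (range K).filter (y < ·), L k * k * h (m + k) ^ 3 / 2 * ((y : ℝ) / k)) * v m := hstar
    _ ≤ (1 - ∑ k ∈ range K, ∑ i ∈ (range K).filter (· < y), E k m i) * v m :=
        mul_le_mul_of_nonneg_right (by linarith) (hv0 m)

end Summit.QuantumFields.BalabanUV.Beta.EriceRemainderEnclosureHistoryAutonomyComparisonAgeCompositionIdentificationEnd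

end
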